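import Summits.NavierStokesRegularity.NavierStokesRegularity.Theorems.SoloSalvageWu2026ConstructExteriorTools
import Summits.NavierStokesRegularity.NavierStokesRegularity.Theorems.SoloSalvageWu2026ConstructLimitTools
import Summits.NavierStokesRegularity.NavierStokesRegularity.Theorems.SoloSalvageWu2026ConstructCompactV
import Summits.NavierStokesRegularity.NavierStokesRegularity.Theorems.SoloSalvageWu2026LogMass
import HarnessLib

/-!
# C177 `Wu2026` — sub-binder (E) of `Step_construct`, integrability half: `V ∈ L^{9/2}_loc({|y| > 1})`
# from a uniform local `L^{9/5}` gradient bound (cell `pub/ns-inputs`, seat `ns-in-wu-con`; route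
# business of `GaldiLiouvilleGate`, item stmt-NavierStokesRegularity-0897)

The second clause of (3.35) (p.13 l.70–83 «V_j is bounded in L^{9/2} on compact subsets of
{|y| > 1} by Sobolev embedding; hence … V ∈ L^{9/2}_loc»): on each admissible ball `B = B(c, r)`,
`1 + r < |c|`, the blow-downs are bounded in `L^{9/5}(B)` (the scale-invariant annular bound (3.18),
`integral_annulus_blowDown_rpow_le`) and their gradients in `L^{9/5}(B)` (hypothesis `hG2`), so by
the tree's Sobolev inequality on balls (`exists_sobolev_nine_halves_ball`) they are bounded in
`L^{9/2}(B)`; the bound passes to the `L⁴_loc`-limit `V` by Fatou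
(`lintegral_rpow_le_of_tendsto_lintegral`), and compact `K ⊆ {|y| > 1}` are covered by finitely
many admissible balls (`exists_centres_cover_exterior`).

Theorems only, standard axioms, no `sorry`.

WHAT THIS IS NOT: not a proof of `Step_construct`; not a claim about NS regularity or blow-up; not
a claim about any author beyond the typed locator.
-/

set_option linter.dupNamespace false

noncomputable section

open MeasureTheory Set Filter Topology Module Metric TopologicalSpace
open scoped ENNReal NNReal Topology RealInnerProductSpace Pointwise

namespace Summit.NavierStokesRegularity.NavierStokesRegularity.Theorems.Wu2026Salvage

open Literature.Analysis.FluidPDE Literature.Analysis.FunctionSpaces Literature.Claims.NS.Wu2026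

/-- **`V ∈ L^{9/2}_loc({|y| > 1})`** for the blow-down limit, from the uniform local `L^{9/5}`
gradient bound at good scales (second half of (3.35), p.13 l.70–83). [cite: Wu2026, (3.35) p.13 l.70–83] -/
theorem integrableOn_nineHalves_of_localGradBound
    (hG2 : ∀ ν : ℝ, 0 < ν → ∀ (v : E3 → E3) (p : E3 → ℝ), IsWuFlow ν v p →
      MemWeakLp v ((9 : ℝ≥0∞) / 2) volume →
      (∀ q : ℝ, 1 < q → q < 9 / 2 → ∃ C : ℝ, ∀ R : ℝ, 0 < R →
        IntegrableOn (fun x => ‖v x‖ ^ q) (annulus R) ∧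
        (∫ x in annulus R, ‖v x‖ ^ q) ^ (1 / q) ≤ C * R ^ (-(2 : ℝ) / 3 + 3 / q)) →
      ∀ n : ℕ → ℕ, Tendsto n atTop atTop →
        (∀ m : ℕ, ∃ B : ℝ, ∀ j : ℕ, max 1 m ≤ j → dyMass v (n j + m) ≤ B) →
      ∀ c : E3, ∀ r : ℝ, 0 < r → 1 + r < ‖c‖ → ∃ C : ℝ, ∀ j : ℕ,
        ∫ y in ball c r, ‖fderiv ℝ (blowDown ((2 : ℝ) ^ n j) v) y‖ ^ ((9 : ℝ) / 5) ≤ C)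
    {ν : ℝ} (hν : 0 < ν) {v : E3 → E3} {p : E3 → ℝ} (hflow : IsWuFlow ν v p)
    (hweak : MemWeakLp v ((9 : ℝ≥0∞) / 2) volume)
    (h318 : ∀ q : ℝ, 1 < q → q < 9 / 2 → ∃ C : ℝ, ∀ R : ℝ, 0 < R →
        IntegrableOn (fun x => ‖v x‖ ^ q) (annulus R) ∧
        (∫ x in annulus R, ‖v x‖ ^ q) ^ (1 / q) ≤ C * R ^ (-(2 : ℝ) / 3 + 3 / q))
    {n : ℕ → ℕ} (hn : Tendsto n atTop atTop)
    (hgood : ∀ m : ℕ, ∃ B : ℝ, ∀ j : ℕ, max 1 m ≤ j → dyMass v (n j + m) ≤ B)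
    {V : E3 → E3} (hVm : AEStronglyMeasurable V volume)
    (hVint : ∀ K : Set E3, IsCompact K → K ⊆ punctured → IntegrableOn (fun y => ‖V y‖ ^ (4 : ℝ)) K)
    (hconvV : ∀ K : Set E3, IsCompact K → K ⊆ punctured →
      Tendsto (fun j => ∫ y in K, ‖blowDown ((2 : ℝ) ^ n j) v y - V y‖ ^ (4 : ℝ)) atTop (𝓝 0))
    {K : Set E3} (hK : IsCompact K) (hKext : K ⊆ exterior) :
    IntegrableOn (fun y => ‖V y‖ ^ ((9 : ℝ) / 2)) K := by
  -- the rescaled fields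
  set Vj : ℕ → E3 → E3 := fun j => blowDown ((2 : ℝ) ^ n j) v with hVj_def
  have hRpos : ∀ j, (0 : ℝ) < (2 : ℝ) ^ n j := fun j => pow_pos two_pos _
  have hVs : ∀ j, ContDiff ℝ (⊤ : ℕ∞) (Vj j) := fun j => contDiff_blowDown hflow.smooth_v _
  have hV1 : ∀ j, ContDiff ℝ 1 (Vj j) := fun j => (hVs j).of_le (by norm_cast)
  have hVc : ∀ j, Continuous (Vj j) := fun j => (hVs j).continuous
  have hDVc : ∀ j, Continuous (fderiv ℝ (Vj j)) := fun j => (hV1 j).continuous_fderiv one_ne_zero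
  have hVjm : ∀ j, AEStronglyMeasurable (Vj j) volume := fun j => (hVc j).aestronglyMeasurable
  -- admissible balls
  obtain ⟨c, hc1, hcover⟩ := exists_centres_cover_exterior
  set r : ℕ → ℝ := fun k => (‖c k‖ - 1) / 3 with hr_def
  have hr : ∀ k, 0 < r k := fun k => by have := hc1 k; simp only [hr_def]; linarith
  have hcr : ∀ k, 1 + r k < ‖c k‖ := fun k => by have := hc1 k; simp only [hr_def]; linarith
  set B : ℕ → Set E3 := fun k => ball (c k) (r k) with hB_def
  have hBmeas : ∀ k, MeasurableSet (B k) := fun k => measurableSet_ball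
  have hBfin : ∀ k, volume (B k) ≠ ∞ := fun k => measure_ball_lt_top.ne
  -- it suffices to treat one ball
  suffices hball : ∀ k, IntegrableOn (fun y => ‖V y‖ ^ ((9 : ℝ) / 2)) (B k) volume by
    have hcov : K ⊆ ⋃ k, B k := fun y hy => by
      obtain ⟨k, hk⟩ := hcover y (hKext hy); exact mem_iUnion.2 ⟨k, hk⟩
    obtain ⟨t, ht⟩ := hK.elim_finite_subcover B (fun k => isOpen_ball) hcov
    exact (integrableOn_finset_iUnion.2 fun k _ => hball k).mono_set ht
  intro k
  have hRk : 0 < ‖c k‖ - r k := by have := hcr k; have := hr k; linarith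
  have hBann : B k ⊆ annulus (‖c k‖ - r k) := ball_subset_annulus_of_one_lt (c k)
  -- (i) uniform `L^{9/5}(B)` bound on `V_j` from (3.18)
  obtain ⟨C95, hC95⟩ := h318 ((9 : ℝ) / 5) (by norm_num) (by norm_num)
  set M95 : ℝ≥0∞ := ENNReal.ofReal ((C95 * (‖c k‖ - r k) ^ (-(2 : ℝ) / 3 + 3 / ((9 : ℝ) / 5))) ^
    ((9 : ℝ) / 5)) with hM95
  have hV95 : ∀ j, ∫⁻ y in B k, ‖Vj j y‖ₑ ^ ((9 : ℝ) / 5) ≤ M95 := by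
    intro j
    have hcont : Continuous fun y => ‖Vj j y‖ ^ ((9 : ℝ) / 5) :=
      (hVc j).norm.rpow_const fun _ => Or.inr (by norm_num)
    calc ∫⁻ y in B k, ‖Vj j y‖ₑ ^ ((9 : ℝ) / 5)
        ≤ ∫⁻ y in annulus (‖c k‖ - r k), ‖Vj j y‖ₑ ^ ((9 : ℝ) / 5) := lintegral_mono_set hBann
      _ = ∫⁻ y in annulus (‖c k‖ - r k), ENNReal.ofReal (‖Vj j y‖ ^ ((9 : ℝ) / 5)) :=
          lintegral_congr fun y => (ofReal_norm_rpow _ (by norm_num)).symm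
      _ = ENNReal.ofReal (∫ y in annulus (‖c k‖ - r k), ‖Vj j y‖ ^ ((9 : ℝ) / 5)) :=
          (ofReal_integral_eq_lintegral_ofReal (integrableOn_annulus_of_continuous hcont _)
            (Eventually.of_forall fun y => Real.rpow_nonneg (norm_nonneg _) _)).symm
      _ ≤ M95 := ENNReal.ofReal_le_ofReal
          (integral_annulus_blowDown_rpow_le (by norm_num) hC95 (hRpos j) hRk)
  -- (ii) the gradient bound (G2)
  obtain ⟨Cg, hCg⟩ := hG2 ν hν v p hflow hweak h318 n hn hgood (c k) (r k) (hr k) (hcr k)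
  have hG95 : ∀ j, ∫⁻ y in B k, ‖fderiv ℝ (Vj j) y‖ₑ ^ ((9 : ℝ) / 5) ≤ ENNReal.ofReal Cg := by
    intro j
    have hcont : Continuous fun y => ‖fderiv ℝ (Vj j) y‖ ^ ((9 : ℝ) / 5) :=
      (hDVc j).norm.rpow_const fun _ => Or.inr (by norm_num)
    calc ∫⁻ y in B k, ‖fderiv ℝ (Vj j) y‖ₑ ^ ((9 : ℝ) / 5)
        = ∫⁻ y in B k, ENNReal.ofReal (‖fderiv ℝ (Vj j) y‖ ^ ((9 : ℝ) / 5)) :=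
          lintegral_congr fun y => (ofReal_norm_rpow _ (by norm_num)).symm
      _ = ENNReal.ofReal (∫ y in B k, ‖fderiv ℝ (Vj j) y‖ ^ ((9 : ℝ) / 5)) :=
          (ofReal_integral_eq_lintegral_ofReal (integrableOn_ball_of_continuous hcont _ _)
            (Eventually.of_forall fun y => Real.rpow_nonneg (norm_nonneg _) _)).symm
      _ ≤ ENNReal.ofReal Cg := ENNReal.ofReal_le_ofReal (hCg j)
  -- (iii) Sobolev: uniform `L^{9/2}(B)` bound
  obtain ⟨Cs, hCs⟩ := exists_sobolev_nine_halves_ball (c k) (r k)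
  have h95ne0 : ((9 : ℝ≥0∞) / 5) ≠ 0 := by norm_num
  have h95netop : ((9 : ℝ≥0∞) / 5) ≠ ∞ :=
    ENNReal.div_ne_top (by norm_num) (by norm_num)
  have h92ne0 : ((9 : ℝ≥0∞) / 2) ≠ 0 := by norm_num
  have h92netop : ((9 : ℝ≥0∞) / 2) ≠ ∞ :=
    ENNReal.div_ne_top (by norm_num) (by norm_num)
  set S : ℝ≥0∞ := Cs * (M95 ^ (1 / ((9 : ℝ) / 5)) + (ENNReal.ofReal Cg) ^ (1 / ((9 : ℝ) / 5)))
    with hS_def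
  have hStop : S ≠ ∞ := ENNReal.mul_ne_top ENNReal.coe_ne_top (ENNReal.add_ne_top.2
    ⟨ENNReal.rpow_ne_top_of_nonneg (by norm_num) ENNReal.ofReal_ne_top,
     ENNReal.rpow_ne_top_of_nonneg (by norm_num) ENNReal.ofReal_ne_top⟩)
  have hV92 : ∀ j, ∫⁻ y in B k, ‖Vj j y‖ₑ ^ ((9 : ℝ) / 2) ≤ S ^ ((9 : ℝ) / 2) := by
    intro j
    have hsob := hCs (Vj j) (hV1 j)
    rw [eLpNorm_eq_lintegral_rpow_enorm_toReal h92ne0 h92netop,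
      eLpNorm_eq_lintegral_rpow_enorm_toReal h95ne0 h95netop,
      eLpNorm_eq_lintegral_rpow_enorm_toReal h95ne0 h95netop, toReal_nine_halves,
      toReal_nine_fifths] at hsob
    have hle : (∫⁻ y in B k, ‖Vj j y‖ₑ ^ ((9 : ℝ) / 2)) ^ (1 / ((9 : ℝ) / 2)) ≤ S := by
      refine hsob.trans ?_
      simp only [hS_def]
      gcongr
      · exact hV95 j
      · exact hG95 j
    have := ENNReal.rpow_le_rpow hle (by norm_num : (0 : ℝ) ≤ (9 : ℝ) / 2)
    rwa [← ENNReal.rpow_mul, show 1 / ((9 : ℝ) / 2) * ((9 : ℝ) / 2) = 1 by norm_num,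
      ENNReal.rpow_one] at this
  -- (iv) `L¹(B)` convergence of `V_j → V`
  have hcl : IsCompact (closedBall (c k) (r k)) := isCompact_closedBall _ _
  have hclp : closedBall (c k) (r k) ⊆ punctured :=
    (closedBall_subset_exterior_of_one_lt (hc1 k)).trans exterior_subset_punctured
  have h4 : Tendsto (fun j => ∫⁻ y in B k, ‖Vj j y - V y‖ₑ ^ (4 : ℝ)) atTop (𝓝 0) := by
    have h := tendsto_lintegral_V_sub_of_integral hflow.smooth_v.continuous hcl hVm
      (hVint _ hcl hclp) (hconvV _ hcl hclp)
    exact tendsto_zero_of_le h fun j => lintegral_mono_set ball_subset_closedBall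
  have hdm : ∀ j, AEMeasurable (fun y => ‖Vj j y - V y‖ₑ) (volume.restrict (B k)) := fun j =>
    ((hVjm j).sub hVm).enorm.restrict
  have hL1 : Tendsto (fun j => ∫⁻ y in B k, ‖Vj j y - V y‖ₑ) atTop (𝓝 0) :=
    tendsto_lintegral_one_of_four (hBfin k) hdm h4
  -- (v) Fatou
  have hV92lim : ∫⁻ y in B k, ‖V y‖ₑ ^ ((9 : ℝ) / 2) ≤ S ^ ((9 : ℝ) / 2) :=
    lintegral_rpow_le_of_tendsto_lintegral (fun j => (hVjm j).restrict) hVm.restrict _ hL1 hV92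
  -- (vi) integrability
  refine ⟨((hVm.norm.aemeasurable.pow_const _).aestronglyMeasurable).restrict, ?_⟩
  rw [hasFiniteIntegral_iff_enorm]
  have heq : ∫⁻ y in B k, ‖‖V y‖ ^ ((9 : ℝ) / 2)‖ₑ = ∫⁻ y in B k, ‖V y‖ₑ ^ ((9 : ℝ) / 2) :=
    lintegral_congr fun y => by
      rw [Real.enorm_eq_ofReal (Real.rpow_nonneg (norm_nonneg _) _), ofReal_norm_rpow _ (by norm_num)]
  rw [heq]
  exact hV92lim.trans_lt (ENNReal.rpow_lt_top_of_nonneg (by norm_num) hStop)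

end Summit.NavierStokesRegularity.NavierStokesRegularity.Theorems.Wu2026Salvage

end

-- WHAT THIS IS NOT: not a claim about NS regularity or blow-up; not a claim about any author beyond the typed locator.
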